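import Summits.BirchSwinnertonDyer.Rank1Residual.Supersingular.GoodSSTowerOfSurj
import Summits.BirchSwinnertonDyer.Rank1Residual.Supersingular.SurjFrobeniusOrderCertificateShape
import Summits.BirchSwinnertonDyer.Rank1Residual.Supersingular.CountPointsPowForm
import Summits.BirchSwinnertonDyer.Rank1Residual.Supersingular.RankZeroSurjThreeCertificates_01
import Summits.BirchSwinnertonDyer.Rank1Residual.Supersingular.RankZeroSurjThreeCertificates_02
import Summits.BirchSwinnertonDyer.Rank1Residual.Supersingular.RankZeroSurjThreeCertificates_03
import Summits.BirchSwinnertonDyer.Rank1Residual.Additive.ThreeTorsionFullCubeDisc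
import Summits.BirchSwinnertonDyer.Rank1Residual.Additive.X4ThreeKuriharaCertKernel
import HarnessLib

/-!
# N6's TAM-DEFECT rows (X8 ∧ `r_an = 0` ∧ surj(3) ∧ `ord₃ ∏c_ℓ = 1`): the level-`𝒩₂` Kurihara-number RECORD
# SHAPE with every side condition kernel-decided, and the RECORDS of the four window cells 9950f1 / 12155c1 /
# 17200bj1 / 18515u1 from cc-eng-6's KURX k = 2 certificates (cell `b2b-bsdres`, supersingular family prover B =
# unit `b2b-bsdres-additive-p3`, gen 21; CLASS-CLOSURE class lead N6·O3)

HONEST FRAMING (run/shared/lean/b2b/bsd-rank1-residual/, verbatim in every file): the goal of the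
cell is to DELETE the COMBINATION-SHAPED residual classes of the Birch–Swinnerton-Dyer formula for
ALL analytic-rank `≤ 1` elliptic curves over `ℚ` — "full BSD formula for every rank `≤ 1` curve in
class `C`" assembled STRICTLY from published theorems — so that the rank-`≤ 1` remainder becomes
exactly the CONSTRUCTION-SHAPED classes, which are TYPED (missing-input `Prop`s), NOT attempted.
This is not "finishing BSD". X8 stays CONSTRUCTION-SHAPED; THEOREMS ONLY (compositions of tree
theorems BY NAME; no definition, no named fact, debt 0); per pair; NOT class theorems; nothing is
booked; N6's sub-partition (79 unit / 7 TAM-DEFECT / 70 3Nn) and marks do not move. Every theorem is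
CONDITIONAL on the ANNOUNCED preprint C.-H. Kim (app. R. Pollack), arXiv:2505.09121 Thm. 1.1 (`hK25s`,
OPEN binder) and on Wuthrich 2014 Prop. 21 (`hW`, PUBLISHED, A6); `h3per`, `hGZK`, `hmod` PUBLISHED.

## Why

Gen 18 (`X8KimTamagawaDefectOPEN.lean`, p264505) proved the EXACT BOUNDARY on a good-3 ∧ tower ∧ `r_an = 0`
row: `BSD(E,3) ⟺ ∃` ONE Kurihara number `δ̃_n ≢ 0 (mod 3^k)` at a CYCLIC level `n ∈ 𝒩_k` with
`1 ≤ k ≤ ord₃∏c_ℓ + 1` — the `≥` half of Kim's Conj. 1.10 being a THEOREM from Wuthrich's upper bound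
(`GoodThree.kimTamagawaDefectGeAt_of_kim2025_OPEN_of_wuthrich`), NOT a conjecture binder; gen 21
(`GoodSSTowerOfSurj.lean`, p306705) feeds the tower from surj(3) alone. On N6's 7 TAM-DEFECT cells
(`ord₃∏c_ℓ = 1`) the certificate is therefore a number `≢ 0 (mod 9)` at a cyclic `n = ℓ₁ℓ₂ ∈ 𝒩₂`. cc-eng-6's
KURX k = 2 profile (`class-closure/N6/kurx3-tamdefect-certificates-2026-08-21.tsv`, fold 21:08Z, engine
impl1x cypari2 `msfromell` KURX-1.6, candidates A3-transversal; controls C1 parity / C2 roots / C3 level-1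
vanishing PASS) found on EACH of the four window cells one level `n ∈ 𝒩₂` with `v₃(δ̃_n) = 1 < k_n = 2`, i.e.
`δ̃_n ≢ 0 (mod 9)`: 9950f1 @ 4404187 = 1747·2521, 12155c1 @ 327781 = 433·757, 17200bj1 @ 57007 = 109·523,
18515u1 @ 298531 = 487·613 (ONE engine at these levels; `icyc` alarm 0). cc-eng-6 read this as a LOWER-BOUND
shape "modulo Kim@3 + Conj. 1.10"; the class lead's reading (this file): by gen 18's boundary theorem it is the
FULL `BSD(E,3)` shape modulo `hK25s` (OPEN) + `hW` (PUBLISHED) + the datum — no Conj. 1.10 binder.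

## What

* §1 `isKolyvaginProduct_pair_of_intModel_of_card`, `isCyclicKolyvaginLevel_pair_of_intModel_of_cube` — for an
  integer model `integralModelInt W = E₀` and two distinct primes `ℓ₁, ℓ₂ ≥ 5`, `ℓᵢ ∤ Δ(E₀)`, `ℓᵢ ≡ 1 (mod 3^k)`,
  point counts `#(E₀ mod ℓᵢ)(𝔽_ℓᵢ) = mᵢ` with `3^k ∣ mᵢ`, and the CUBE TESTS `Δ(E₀ mod ℓᵢ) ≠ 0`,
  `Δ(E₀ mod ℓᵢ)^{(ℓᵢ−1)/3} ≠ 1`: `ℓ₁ℓ₂ ∈ 𝒩_k` (n1011 `Additive.isKolyvaginPrime_of_intModel_of_card` +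
  `Kato.IsKolyvaginProduct.mul`) and `ℓ₁ℓ₂` is a CYCLIC Kolyvagin level (n1011-p15's
  `Additive.card_three_torsion_le_of_intModel_of_pow_div_three_ne_one` at each prime).
* §2 `X8RankZero.bsdp_three_of_kim2025_OPEN_of_ainvs_of_kuriharaNumber_ne_zero_pair` — the literal-equation
  RECORD SHAPE: minimality explicit, class X8 from `3 ∤ Δ` and `countPoints [a] 3 ∈ {1,7}`, `hsurj` (= gen 21's
  certificate `surj_x8r0_<label>_3`), `r_an = 0`, the level data of §1 (all `decide`), the Tamagawa bound
  `k ≤ ord₃ ∏c_ℓ + 1` (Cremona datum), a surjective `ψ` and `kuriharaNumber D.f (3^k) n ψ ≠ 0` (binder) ⇒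
  `BSD(E,3)` — gen 21's `X8RankZero.bsdp_three_of_kim2025_OPEN_of_wuthrich_of_kuriharaNumber_ne_zero_of_surj`.
* §3 RECORDS `bsdp_x8r0kim9_<label>` for the four window TAM-DEFECT cells (k = 2).

References: [Kim2025RefinedTNC] Thm. 1.1, §8.1.2 (ANNOUNCED, OPEN binder); [Kim2022StructureSelmer] §1.2.2,
Conj. 1.10; [Wuthrich2014] Lemma 20 (p. 399), Prop. 21 (p. 400); [SilvermanAEC2009] III.1, VII.1, VII.5;
[IrelandRosen1990] Prop. 5.1.2; [Kraus1989]; [Cremona2006] Table 1; [Miller2011LMS] Def. 1.1.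
-/

set_option autoImplicit false

noncomputable section

open scoped Classical MatrixGroups ModularForm

open CongruenceSubgroup WeierstrassCurve Literature.NumberTheory.EllipticCurves
  Literature.NumberTheory.EllipticCurves.ModularForms
  Literature.NumberTheory.EllipticCurves.Rank1Residual
  Literature.NumberTheory.EllipticCurves.Rank1Residual.Typed
  Literature.NumberTheory.EllipticCurves.Rank1Residual.X11RankOneCertificates
  Literature.NumberTheory.EllipticCurves.Wuthrich2014
  Summit.BirchSwinnertonDyer.BirchSwinnertonDyer.Rank1Residual.IntModel
  Summit.BirchSwinnertonDyer.BirchSwinnertonDyer.Rank1Residual.X11RankOne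
  Summit.BirchSwinnertonDyer.Rank1Residual.X11b
  Summit.BirchSwinnertonDyer.Rank1Residual.Additive

namespace Summit.BirchSwinnertonDyer.Rank1Residual.Supersingular

/-! ### §1 A cyclic level `ℓ₁ℓ₂ ∈ 𝒩_k` read off an integer model -/

section IntModel

variable {W : WeierstrassCurve ℚ} [W.IsElliptic] [W.IsGloballyMinimal] {E₀ : WeierstrassCurve ℤ}

/-- `3 ∣ ℓ − 1` from `ℓ ≡ 1 (mod 3^k)`, `k ≥ 1`. [folklore] -/
private theorem three_dvd_sub_one_of_modEq_pow' {ℓ k : ℕ} (hk : 1 ≤ k) (h1 : ℓ ≡ 1 [MOD 3 ^ k]) :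
    3 ∣ ℓ - 1 := by
  have h3 : 1 ≡ ℓ [MOD 3] := (h1.of_dvd (dvd_pow_self 3 (by omega))).symm
  rcases Nat.eq_zero_or_pos ℓ with rfl | hpos
  · simp
  · exact (Nat.modEq_iff_dvd' hpos).mp h3

/-- **`ℓ₁ℓ₂ ∈ 𝒩_k(E,3)` READ OFF AN INTEGER MODEL**: distinct primes `ℓ₁, ℓ₂ ≠ 3` with `ℓᵢ ∤ Δ(E₀)`,
`ℓᵢ ≡ 1 (mod 3^k)` and point counts `#(E₀ mod ℓᵢ)(𝔽_ℓᵢ) = mᵢ`, `3^k ∣ mᵢ`.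
[cite: Kim2022StructureSelmer, §1.2.2 (PDF p. 4)] -/
theorem isKolyvaginProduct_pair_of_intModel_of_card (hI : integralModelInt W = E₀) (k ℓ₁ ℓ₂ : ℕ)
    [Fact ℓ₁.Prime] [Fact ℓ₂.Prime] (hne : ℓ₁ ≠ ℓ₂) (h3₁ : ℓ₁ ≠ 3) (h3₂ : ℓ₂ ≠ 3)
    (hΔ₁ : ¬ (ℓ₁ : ℤ) ∣ E₀.Δ) (hΔ₂ : ¬ (ℓ₂ : ℤ) ∣ E₀.Δ) (h1₁ : ℓ₁ ≡ 1 [MOD 3 ^ k])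
    (h1₂ : ℓ₂ ≡ 1 [MOD 3 ^ k]) {m₁ m₂ : ℕ}
    (hc₁ : Nat.card ((E₀.map (Int.castRingHom (ZMod ℓ₁))).toAffine.Point) = m₁)
    (hc₂ : Nat.card ((E₀.map (Int.castRingHom (ZMod ℓ₂))).toAffine.Point) = m₂)
    (hd₁ : 3 ^ k ∣ m₁) (hd₂ : 3 ^ k ∣ m₂) : Kato.IsKolyvaginProduct W 3 k (ℓ₁ * ℓ₂) :=
  haveI : Fact (Nat.Prime 3) := ⟨by norm_num⟩
  isKolyvaginProduct_mul (isKolyvaginPrime_of_intModel_of_card hI 3 k ℓ₁ h3₁ hΔ₁ h1₁ hc₁ hd₁)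
    (isKolyvaginPrime_of_intModel_of_card hI 3 k ℓ₂ h3₂ hΔ₂ h1₂ hc₂ hd₂) hne

/-- **`ℓ₁ℓ₂` is a CYCLIC Kolyvagin level** (`IsCyclicKolyvaginLevel W 3 (ℓ₁ℓ₂)`: `ℓ₁ℓ₂ ∈ 𝒩₁` and
`#Ẽ(𝔽_ℓ)[3] ≤ 3` at each prime factor) from the level-`k` data of
`isKolyvaginProduct_pair_of_intModel_of_card` (`k ≥ 1`) and the CUBE TESTS `Δ(E₀ mod ℓᵢ) ≠ 0`,
`Δ(E₀ mod ℓᵢ)^{(ℓᵢ−1)/3} ≠ 1` (`ℓᵢ ≥ 5`). [cite: Kim2022StructureSelmer, §1.2.2 and Thm. 1.10 (1)]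
[cite: SilvermanAEC2009, III.1 and Exercise 3.7] -/
theorem isCyclicKolyvaginLevel_pair_of_intModel_of_cube (hI : integralModelInt W = E₀) {k : ℕ}
    (hk : 1 ≤ k) (ℓ₁ ℓ₂ : ℕ) [Fact ℓ₁.Prime] [Fact ℓ₂.Prime] (hne : ℓ₁ ≠ ℓ₂) (h5₁ : 5 ≤ ℓ₁)
    (h5₂ : 5 ≤ ℓ₂) (hΔ₁ : ¬ (ℓ₁ : ℤ) ∣ E₀.Δ) (hΔ₂ : ¬ (ℓ₂ : ℤ) ∣ E₀.Δ) (h1₁ : ℓ₁ ≡ 1 [MOD 3 ^ k])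
    (h1₂ : ℓ₂ ≡ 1 [MOD 3 ^ k]) {m₁ m₂ : ℕ}
    (hc₁ : Nat.card ((E₀.map (Int.castRingHom (ZMod ℓ₁))).toAffine.Point) = m₁)
    (hc₂ : Nat.card ((E₀.map (Int.castRingHom (ZMod ℓ₂))).toAffine.Point) = m₂)
    (hd₁ : 3 ^ k ∣ m₁) (hd₂ : 3 ^ k ∣ m₂)
    (hz₁ : (E₀.map (Int.castRingHom (ZMod ℓ₁))).Δ ≠ 0)
    (hχ₁ : (E₀.map (Int.castRingHom (ZMod ℓ₁))).Δ ^ ((ℓ₁ - 1) / 3) ≠ 1)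
    (hz₂ : (E₀.map (Int.castRingHom (ZMod ℓ₂))).Δ ≠ 0)
    (hχ₂ : (E₀.map (Int.castRingHom (ZMod ℓ₂))).Δ ^ ((ℓ₂ - 1) / 3) ≠ 1) :
    IsCyclicKolyvaginLevel W 3 (ℓ₁ * ℓ₂) := by
  refine ⟨(isKolyvaginProduct_pair_of_intModel_of_card hI k ℓ₁ ℓ₂ hne (by omega) (by omega) hΔ₁ hΔ₂
    h1₁ h1₂ hc₁ hc₂ hd₁ hd₂).mono hk, fun ℓ hℓ hdvd => ?_⟩
  rcases (Nat.Prime.dvd_mul hℓ.out).mp hdvd with hd | hd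
  · obtain rfl := (Nat.prime_dvd_prime_iff_eq hℓ.out Fact.out).mp hd
    exact card_three_torsion_le_of_intModel_of_pow_div_three_ne_one hI ℓ hz₁ hχ₁ h5₁
      (three_dvd_sub_one_of_modEq_pow' hk h1₁)
  · obtain rfl := (Nat.prime_dvd_prime_iff_eq hℓ.out Fact.out).mp hd
    exact card_three_torsion_le_of_intModel_of_pow_div_three_ne_one hI ℓ hz₂ hχ₂ h5₂
      (three_dvd_sub_one_of_modEq_pow' hk h1₂)

end IntModel

/-! ### §2 The literal-equation RECORD SHAPE (X8 ∧ `r_an = 0`, level `ℓ₁ℓ₂ ∈ 𝒩_k` cyclic,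
`k ≤ ord₃∏c_ℓ + 1`) -/

section Literal

/-- **RECORD SHAPE (N6's TAM-DEFECT rows; any `k ≤ ord₃∏c_ℓ + 1`).** For an integer equation
`[a₁,…,a₆]`: `hmin` global minimality (explicit), `3 ∤ Δ`, `countPoints [a] 3 ∈ {1,7}` (class X8); two
distinct primes `ℓ₁, ℓ₂ ≥ 5`, `ℓᵢ ∤ Δ`, `ℓᵢ ≡ 1 (mod 3^k)`, `#(E mod ℓᵢ)(𝔽_ℓᵢ) = mᵢ`, `3^k ∣ mᵢ`, cube tests
`(Δ : ℤ/ℓᵢ) ≠ 0`, `(Δ : ℤ/ℓᵢ)^{(ℓᵢ−1)/3} ≠ 1` — ALL kernel-decidable (the prime facts are the named instance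
binders `hℓ₁`, `hℓ₂`); the level `n = ℓ₁ℓ₂` as a literal with `[hn0 : NeZero n]`; binders: `hsurj` (gen 21's
certificate), `r_an = 0`, `D`, `k ≤ ord₃ ∏c_ℓ + 1` (Cremona), a `ψ` surjective at both primes and
`kuriharaNumber D.f (3^k) n ψ ≠ 0` ⇒ **`BSD(E,3)`**. CONDITIONAL on `hK25s` (OPEN) + `hW` (PUBLISHED).
Per pair; NOT a class theorem; nothing booked. [claim: Kim2025RefinedTNC, status: under-review]
[cite: Kim2025RefinedTNC, Thm. 1.1, §8.1.2 (ANNOUNCED, OPEN binder)] [cite: Wuthrich2014, Lemma 20 (p. 399) and Prop. 21 (p. 400)]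
[cite: Kim2022StructureSelmer, §1.2.2 and Thm. 1.10 (1)] [cite: SilvermanAEC2009, III.1, VII.1 Remark 1.1, VII.5 Prop. 5.1(a)]
[cite: IrelandRosen1990, Prop. 5.1.2 and §8.1] [cite: Miller2011LMS, Def. 1.1] -/
theorem X8RankZero.bsdp_three_of_kim2025_OPEN_of_ainvs_of_kuriharaNumber_ne_zero_pair
    (hK25s : Kim2025.thm11_kimShaLength_of_integralPeriod_OPEN) (hW : sha_dvd_analyticSha)
    (hGZK : rank_eq_analyticRank_of_analyticRank_le_one) (hmod : hasEntireLFunction_rat)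
    (h3per : realPeriodRat_eq_unit_mul_plusPeriod_three)
    (a1 a2 a3 a4 a6 : ℤ) (hmin : (⟨a1, a2, a3, a4, a6⟩ : WeierstrassCurve ℚ).IsGloballyMinimal)
    (h3Δ : ¬ (3 : ℤ) ∣ discOf [a1, a2, a3, a4, a6]) {n₃ : ℕ}
    (hc₃ : countPoints [a1, a2, a3, a4, a6] 3 = n₃) (hn17 : n₃ = 1 ∨ n₃ = 7)
    (hsurj : Surj (⟨a1, a2, a3, a4, a6⟩ : WeierstrassCurve ℚ) 3)
    (hr : (⟨a1, a2, a3, a4, a6⟩ : WeierstrassCurve ℚ).analyticRank = 0)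
    {N : ℕ} [NeZero N] (D : ModularParametrizationData (⟨a1, a2, a3, a4, a6⟩ : WeierstrassCurve ℚ) N)
    {k : ℕ} (hk1 : 1 ≤ k)
    (hk : k ≤ padicValNat 3 (⟨a1, a2, a3, a4, a6⟩ : WeierstrassCurve ℚ).tamagawaProduct + 1)
    (ℓ₁ ℓ₂ : ℕ) (hne : ℓ₁ ≠ ℓ₂) (h5₁ : 5 ≤ ℓ₁) (h5₂ : 5 ≤ ℓ₂)
    (hΔ₁ : ¬ (ℓ₁ : ℤ) ∣ discOf [a1, a2, a3, a4, a6]) (hΔ₂ : ¬ (ℓ₂ : ℤ) ∣ discOf [a1, a2, a3, a4, a6])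
    (h1₁ : ℓ₁ ≡ 1 [MOD 3 ^ k]) (h1₂ : ℓ₂ ≡ 1 [MOD 3 ^ k]) {m₁ m₂ : ℕ}
    (hcnt₁ : Nat.card (((⟨a1, a2, a3, a4, a6⟩ : WeierstrassCurve ℤ).map
      (Int.castRingHom (ZMod ℓ₁))).toAffine.Point) = m₁)
    (hcnt₂ : Nat.card (((⟨a1, a2, a3, a4, a6⟩ : WeierstrassCurve ℤ).map
      (Int.castRingHom (ZMod ℓ₂))).toAffine.Point) = m₂)
    (hd₁ : 3 ^ k ∣ m₁) (hd₂ : 3 ^ k ∣ m₂)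
    (hz₁ : ((discOf [a1, a2, a3, a4, a6] : ℤ) : ZMod ℓ₁) ≠ 0)
    (hχ₁ : ((discOf [a1, a2, a3, a4, a6] : ℤ) : ZMod ℓ₁) ^ ((ℓ₁ - 1) / 3) ≠ 1)
    (hz₂ : ((discOf [a1, a2, a3, a4, a6] : ℤ) : ZMod ℓ₂) ≠ 0)
    (hχ₂ : ((discOf [a1, a2, a3, a4, a6] : ℤ) : ZMod ℓ₂) ^ ((ℓ₂ - 1) / 3) ≠ 1)
    [hℓ₁ : Fact ℓ₁.Prime] [hℓ₂ : Fact ℓ₂.Prime] (n : ℕ) [hn0 : NeZero n] (hn : ℓ₁ * ℓ₂ = n)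
    (ψ : (ℓ : ℕ) → (ZMod ℓ)ˣ →* Multiplicative (ZMod (3 ^ k)))
    (hψ : ∀ ℓ ∈ n.primeFactors, Function.Surjective (ψ ℓ))
    (hδ : kuriharaNumber D.f (3 ^ k) n ψ ≠ 0) :
    BSDp (⟨a1, a2, a3, a4, a6⟩ : WeierstrassCurve ℚ) 3 := by
  subst hn
  have h0 : discOf [a1, a2, a3, a4, a6] ≠ 0 := fun h ↦ h3Δ (by rw [h]; exact dvd_zero _)
  haveI := isElliptic_of_discOf_ne_zero a1 a2 a3 a4 a6 h0
  haveI := hmin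
  haveI : Fact (Nat.Prime 3) := ⟨by norm_num⟩
  have hI : integralModelInt (⟨a1, a2, a3, a4, a6⟩ : WeierstrassCurve ℚ) = ⟨a1, a2, a3, a4, a6⟩ :=
    integralModelInt_eq_of_map_eq _ (map_mk_int a1 a2 a3 a4 a6)
  have hΔ₁' : ((⟨a1, a2, a3, a4, a6⟩ : WeierstrassCurve ℤ).map (Int.castRingHom (ZMod ℓ₁))).Δ =
      ((discOf [a1, a2, a3, a4, a6] : ℤ) : ZMod ℓ₁) := by
    rw [WeierstrassCurve.map_Δ, intCurve_Δ, eq_intCast]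
  have hΔ₂' : ((⟨a1, a2, a3, a4, a6⟩ : WeierstrassCurve ℤ).map (Int.castRingHom (ZMod ℓ₂))).Δ =
      ((discOf [a1, a2, a3, a4, a6] : ℤ) : ZMod ℓ₂) := by
    rw [WeierstrassCurve.map_Δ, intCurve_Δ, eq_intCast]
  have hX : ClassX8 (⟨a1, a2, a3, a4, a6⟩ : WeierstrassCurve ℚ) 3 :=
    classX8_of_intModel hI (by rw [intCurve_Δ]; exact h3Δ)
      (natCard_point_eq_of_countPoints a1 a2 a3 a4 a6 3 (by decide) h3Δ hc₃) hn17
  have hprod := isKolyvaginProduct_pair_of_intModel_of_card hI k ℓ₁ ℓ₂ hne (by omega) (by omega)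
    (by rw [intCurve_Δ]; exact hΔ₁) (by rw [intCurve_Δ]; exact hΔ₂) h1₁ h1₂ hcnt₁ hcnt₂ hd₁ hd₂
  have hcyc := isCyclicKolyvaginLevel_pair_of_intModel_of_cube hI hk1 ℓ₁ ℓ₂ hne h5₁ h5₂
    (by rw [intCurve_Δ]; exact hΔ₁) (by rw [intCurve_Δ]; exact hΔ₂) h1₁ h1₂ hcnt₁ hcnt₂ hd₁ hd₂
    (by rw [hΔ₁']; exact hz₁) (by rw [hΔ₁']; exact hχ₁) (by rw [hΔ₂']; exact hz₂) (by rw [hΔ₂']; exact hχ₂)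
  exact X8RankZero.bsdp_three_of_kim2025_OPEN_of_wuthrich_of_kuriharaNumber_ne_zero_of_surj _ hK25s hW
    hGZK hmod h3per hr hX hsurj D hcyc hprod hk ψ hψ hδ

end Literal


/-! ### §3 RECORDS — N6's four window TAM-DEFECT cells (k = 2; cc-eng-6 KURX k = 2, ONE engine) -/

section Records
/-- **`9950f1`** (N6 TAM-DEFECT: X8 ∧ `r_an = 0` ∧ surj(3), `∏c_ℓ = 6` (`ord₃ = 1`), `#Ш_an = 9`; Cremona model `[1, -1, 0, -787492, -268781584]`, `N = 9950`): `BSD(E,3)` from ONE level-`𝒩₂` Kurihara number at `n = 4404187 = 1747·2521` — KERNEL: `ℓ ≡ 1 (mod 9)` for both primes, `#Ẽ(𝔽_{1747}) = 1737` (`a = 11`), `#Ẽ(𝔽_{2521}) = 2475` (`a = 47`), `9 ∣` both counts (so `n ∈ 𝒩₂`), cube tests `Δ^{(ℓ−1)/3} ≡ 1375, 675 ≢ 1` (cyclic `3`-parts), class X8 (`#Ẽ(𝔽₃) = 1`), minimality, surj(3) (`surj_x8r0_9950f1_3`); BINDERS: `htam : 2 ≤ ord₃∏c_ℓ + 1`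 (Cremona `∏c_ℓ = 6`), `hδ`: cc-eng-6 KURX k = 2 fold `N6/kurx3-tamdefect-certificates-2026-08-21.tsv` — `v₃(δ̃_n) = 1 < k_n = 2` at `n = 4404187` (informative: `δ̃_n ≢ 0 mod 9`), ONE engine (impl1x cypari2 msfromell KURX-1.6), controls C1/C2/C3 PASS, icyc alarm 0; second ν = 2 level 166879 with v = 2 (not informative). CONDITIONAL on `hK25s` (OPEN) + `hW` (PUBLISHED); `r_an = 0` Cremona. Per pair; NOT a class theorem; nothing booked; a second engine at this level is the ask. [claim: Kim2025RefinedTNC, status: under-review] [cite: Kim2025RefinedTNC, Thm. 1.1, §8.1.2 (ANNOUNCED, OPEN binder)] [cite: Wuthrich2014, Prop. 21 (p. 400)] [cite: Kim2022StructureSelmer, §1.2.2] [cite: Cremona2006, Table 1 (Cremona label 9950f1)] -/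
theorem bsdp_x8r0kim9_9950f1
    (hK25s : Kim2025.thm11_kimShaLength_of_integralPeriod_OPEN) (hW : sha_dvd_analyticSha)
    (hGZK : rank_eq_analyticRank_of_analyticRank_le_one) (hmod : hasEntireLFunction_rat)
    (h3per : realPeriodRat_eq_unit_mul_plusPeriod_three)
    (W : WeierstrassCurve ℚ) (hWeq : W = ⟨1, -1, 0, -787492, -268781584⟩) (hr : W.analyticRank = 0)
    (htam : 2 ≤ padicValNat 3 W.tamagawaProduct + 1)
    {N : ℕ} [NeZero N] (D : ModularParametrizationData W N)
    (ψ : (ℓ : ℕ) → (ZMod ℓ)ˣ →* Multiplicative (ZMod (3 ^ 2)))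
    (hψ : ∀ ℓ ∈ (4404187 : ℕ).primeFactors, Function.Surjective (ψ ℓ))
    (hδ : kuriharaNumber D.f (3 ^ 2) 4404187 ψ ≠ 0) : BSDp W 3 := by
  subst hWeq
  exact X8RankZero.bsdp_three_of_kim2025_OPEN_of_ainvs_of_kuriharaNumber_ne_zero_pair hK25s hW hGZK hmod
    h3per 1 (-1) 0 (-787492) (-268781584)
    (isGloballyMinimal_of_krausCriterion_bounded 1 (-1) 0 (-787492) (-268781584)
      (by decide +kernel) (by decide +kernel) (by decide +kernel))
    (by decide) (n₃ := 1) (by decide +kernel) (by decide) surj_x8r0_9950f1_3 hr D (k := 2) (by norm_num)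
    htam 1747 2521 (by norm_num) (by norm_num) (by norm_num) (by decide) (by decide) (by decide) (by decide)
    (m₁ := 1737) (m₂ := 2475)
    (by haveI : Fact (Nat.Prime 1747) := ⟨by norm_num⟩
        exact natCard_point_eq_of_powForm 1 (-1) 0 (-787492) (-268781584) 1747 (by norm_num) (by decide)
          (by decide +kernel))
    (by haveI : Fact (Nat.Prime 2521) := ⟨by norm_num⟩
        exact natCard_point_eq_of_powForm 1 (-1) 0 (-787492) (-268781584) 2521 (by norm_num) (by decide)
          (by decide +kernel))
    (by decide) (by decide) (by decide +kernel) (by decide +kernel) (by decide +kernel) (by decide +kernel)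
    (hℓ₁ := ⟨by norm_num⟩) (hℓ₂ := ⟨by norm_num⟩) 4404187 (hn0 := ⟨by norm_num⟩) (by norm_num) ψ hψ hδ

/-- **`12155c1`** (N6 TAM-DEFECT: X8 ∧ `r_an = 0` ∧ surj(3), `∏c_ℓ = 3` (`ord₃ = 1`), `#Ш_an = 9`; Cremona model `[1, -1, 0, -11230, -455389]`, `N = 12155`): `BSD(E,3)` from ONE level-`𝒩₂` Kurihara number at `n = 327781 = 433·757` — KERNEL: `ℓ ≡ 1 (mod 9)` for both primes, `#Ẽ(𝔽_{433}) = 396` (`a = 38`), `#Ẽ(𝔽_{757}) = 810` (`a = -52`), `9 ∣` both counts (so `n ∈ 𝒩₂`), cube tests `Δ^{(ℓ−1)/3} ≡ 198, 27 ≢ 1` (cyclic `3`-parts), class X8 (`#Ẽ(𝔽₃) = 1`), minimality, surj(3) (`surj_x8r0_12155c1_3`); BINDERS: `htam : 2 ≤ ord₃∏c_ℓ + 1` (Cremona `∏c_ℓ = 3`), `hδ`: cc-eng-6 KURX k = 2 fold `N6/kurx3-tamdefect-certificates-2026-08-21.tsv` — `v₃(δ̃_n) = 1 < k_n = 2` at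 `n = 327781` (informative: `δ̃_n ≢ 0 mod 9`), ONE engine (impl1x cypari2 msfromell KURX-1.6), controls C1/C2/C3 PASS, icyc alarm 0. CONDITIONAL on `hK25s` (OPEN) + `hW` (PUBLISHED); `r_an = 0` Cremona. Per pair; NOT a class theorem; nothing booked; a second engine at this level is the ask. [claim: Kim2025RefinedTNC, status: under-review] [cite: Kim2025RefinedTNC, Thm. 1.1, §8.1.2 (ANNOUNCED, OPEN binder)] [cite: Wuthrich2014, Prop. 21 (p. 400)] [cite: Kim2022StructureSelmer, §1.2.2] [cite: Cremona2006, Table 1 (Cremona label 12155c1)] -/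
theorem bsdp_x8r0kim9_12155c1
    (hK25s : Kim2025.thm11_kimShaLength_of_integralPeriod_OPEN) (hW : sha_dvd_analyticSha)
    (hGZK : rank_eq_analyticRank_of_analyticRank_le_one) (hmod : hasEntireLFunction_rat)
    (h3per : realPeriodRat_eq_unit_mul_plusPeriod_three)
    (W : WeierstrassCurve ℚ) (hWeq : W = ⟨1, -1, 0, -11230, -455389⟩) (hr : W.analyticRank = 0)
    (htam : 2 ≤ padicValNat 3 W.tamagawaProduct + 1)
    {N : ℕ} [NeZero N] (D : ModularParametrizationData W N)
    (ψ : (ℓ : ℕ) → (ZMod ℓ)ˣ →* Multiplicative (ZMod (3 ^ 2)))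
    (hψ : ∀ ℓ ∈ (327781 : ℕ).primeFactors, Function.Surjective (ψ ℓ))
    (hδ : kuriharaNumber D.f (3 ^ 2) 327781 ψ ≠ 0) : BSDp W 3 := by
  subst hWeq
  exact X8RankZero.bsdp_three_of_kim2025_OPEN_of_ainvs_of_kuriharaNumber_ne_zero_pair hK25s hW hGZK hmod
    h3per 1 (-1) 0 (-11230) (-455389)
    (isGloballyMinimal_of_krausCriterion_bounded 1 (-1) 0 (-11230) (-455389)
      (by decide +kernel) (by decide +kernel) (by decide +kernel))
    (by decide) (n₃ := 1) (by decide +kernel) (by decide) surj_x8r0_12155c1_3 hr D (k := 2) (by norm_num)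
    htam 433 757 (by norm_num) (by norm_num) (by norm_num) (by decide) (by decide) (by decide) (by decide)
    (m₁ := 396) (m₂ := 810)
    (by haveI : Fact (Nat.Prime 433) := ⟨by norm_num⟩
        exact natCard_point_eq_of_powForm 1 (-1) 0 (-11230) (-455389) 433 (by norm_num) (by decide)
          (by decide +kernel))
    (by haveI : Fact (Nat.Prime 757) := ⟨by norm_num⟩
        exact natCard_point_eq_of_powForm 1 (-1) 0 (-11230) (-455389) 757 (by norm_num) (by decide)
          (by decide +kernel))
    (by decide) (by decide) (by decide +kernel) (by decide +kernel) (by decide +kernel) (by decide +kernel)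
    (hℓ₁ := ⟨by norm_num⟩) (hℓ₂ := ⟨by norm_num⟩) 327781 (hn0 := ⟨by norm_num⟩) (by norm_num) ψ hψ hδ

/-- **`17200bj1`** (N6 TAM-DEFECT: X8 ∧ `r_an = 0` ∧ surj(3), `∏c_ℓ = 12` (`ord₃ = 1`), `#Ш_an = 9`; Cremona model `[0, 0, 0, -4862875, -4127533750]`, `N = 17200`): `BSD(E,3)` from ONE level-`𝒩₂` Kurihara number at `n = 57007 = 109·523` — KERNEL: `ℓ ≡ 1 (mod 9)` for both primes, `#Ẽ(𝔽_{109}) = 90` (`a = 20`), `#Ẽ(𝔽_{523}) = 549` (`a = -25`), `9 ∣` both counts (so `n ∈ 𝒩₂`), cube tests `Δ^{(ℓ−1)/3} ≡ 45, 60 ≢ 1` (cyclic `3`-parts), class X8 (`#Ẽ(𝔽₃) = 1`), minimality, surj(3) (`surj_x8r0_17200bj1_3`); BINDERS: `htam : 2 ≤ ord₃∏c_ℓ + 1` (Cremona `∏c_ℓ = 12`), `hδ`: cc-eng-6 KURX k = 2 fold `N6/kurx3-tamdefect-certificates-2026-08-21.tsv` — `v₃(δ̃_n) = 1 < k_n =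 2` at `n = 57007` (informative: `δ̃_n ≢ 0 mod 9`), ONE engine (impl1x cypari2 msfromell KURX-1.6), controls C1/C2/C3 PASS, icyc alarm 0. CONDITIONAL on `hK25s` (OPEN) + `hW` (PUBLISHED); `r_an = 0` Cremona. Per pair; NOT a class theorem; nothing booked; a second engine at this level is the ask. [claim: Kim2025RefinedTNC, status: under-review] [cite: Kim2025RefinedTNC, Thm. 1.1, §8.1.2 (ANNOUNCED, OPEN binder)] [cite: Wuthrich2014, Prop. 21 (p. 400)] [cite: Kim2022StructureSelmer, §1.2.2] [cite: Cremona2006, Table 1 (Cremona label 17200bj1)] -/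
theorem bsdp_x8r0kim9_17200bj1
    (hK25s : Kim2025.thm11_kimShaLength_of_integralPeriod_OPEN) (hW : sha_dvd_analyticSha)
    (hGZK : rank_eq_analyticRank_of_analyticRank_le_one) (hmod : hasEntireLFunction_rat)
    (h3per : realPeriodRat_eq_unit_mul_plusPeriod_three)
    (W : WeierstrassCurve ℚ) (hWeq : W = ⟨0, 0, 0, -4862875, -4127533750⟩) (hr : W.analyticRank = 0)
    (htam : 2 ≤ padicValNat 3 W.tamagawaProduct + 1)
    {N : ℕ} [NeZero N] (D : ModularParametrizationData W N)
    (ψ : (ℓ : ℕ) → (ZMod ℓ)ˣ →* Multiplicative (ZMod (3 ^ 2)))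
    (hψ : ∀ ℓ ∈ (57007 : ℕ).primeFactors, Function.Surjective (ψ ℓ))
    (hδ : kuriharaNumber D.f (3 ^ 2) 57007 ψ ≠ 0) : BSDp W 3 := by
  subst hWeq
  exact X8RankZero.bsdp_three_of_kim2025_OPEN_of_ainvs_of_kuriharaNumber_ne_zero_pair hK25s hW hGZK hmod
    h3per 0 0 0 (-4862875) (-4127533750)
    (isGloballyMinimal_of_krausCriterion₃_bounded 0 0 0 (-4862875) (-4127533750)
      (by decide +kernel) (by decide +kernel)
      (by set_option synthInstance.maxSize 2000 in decide +kernel))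
    (by decide) (n₃ := 1) (by decide +kernel) (by decide) surj_x8r0_17200bj1_3 hr D (k := 2) (by norm_num)
    htam 109 523 (by norm_num) (by norm_num) (by norm_num) (by decide) (by decide) (by decide) (by decide)
    (m₁ := 90) (m₂ := 549)
    (by haveI : Fact (Nat.Prime 109) := ⟨by norm_num⟩
        exact natCard_point_eq_of_powForm 0 0 0 (-4862875) (-4127533750) 109 (by norm_num) (by decide)
          (by decide +kernel))
    (by haveI : Fact (Nat.Prime 523) := ⟨by norm_num⟩
        exact natCard_point_eq_of_powForm 0 0 0 (-4862875) (-4127533750) 523 (by norm_num) (by decide)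
          (by decide +kernel))
    (by decide) (by decide) (by decide +kernel) (by decide +kernel) (by decide +kernel) (by decide +kernel)
    (hℓ₁ := ⟨by norm_num⟩) (hℓ₂ := ⟨by norm_num⟩) 57007 (hn0 := ⟨by norm_num⟩) (by norm_num) ψ hψ hδ

/-- **`18515u1`** (N6 TAM-DEFECT: X8 ∧ `r_an = 0` ∧ surj(3), `∏c_ℓ = 6` (`ord₃ = 1`), `#Ш_an = 9`; Cremona model `[0, 0, 1, -6877, -599225]`, `N = 18515`): `BSD(E,3)` from ONE level-`𝒩₂` Kurihara number at `n = 298531 = 487·613` — KERNEL: `ℓ ≡ 1 (mod 9)` for both primes, `#Ẽ(𝔽_{487}) = 486` (`a = 2`), `#Ẽ(𝔽_{613}) = 630` (`a = -16`), `9 ∣` both counts (so `n ∈ 𝒩₂`), cube tests `Δ^{(ℓ−1)/3} ≡ 254, 547 ≢ 1` (cyclic `3`-parts), class X8 (`#Ẽ(𝔽₃) = 1`), minimality, surj(3) (`surj_x8r0_18515u1_3`); BINDERS: `htam : 2 ≤ ord₃∏c_ℓ + 1` (Cremona `∏c_ℓ = 6`), `hδ`: cc-eng-6 KURX k = 2 fold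 `N6/kurx3-tamdefect-certificates-2026-08-21.tsv` — `v₃(δ̃_n) = 1 < k_n = 2` at `n = 298531` (informative: `δ̃_n ≢ 0 mod 9`), ONE engine (impl1x cypari2 msfromell KURX-1.6), controls C1/C2/C3 PASS, icyc alarm 0. CONDITIONAL on `hK25s` (OPEN) + `hW` (PUBLISHED); `r_an = 0` Cremona. Per pair; NOT a class theorem; nothing booked; a second engine at this level is the ask. [claim: Kim2025RefinedTNC, status: under-review] [cite: Kim2025RefinedTNC, Thm. 1.1, §8.1.2 (ANNOUNCED, OPEN binder)] [cite: Wuthrich2014, Prop. 21 (p. 400)] [cite: Kim2022StructureSelmer, §1.2.2] [cite: Cremona2006, Table 1 (Cremona label 18515u1)] -/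
theorem bsdp_x8r0kim9_18515u1
    (hK25s : Kim2025.thm11_kimShaLength_of_integralPeriod_OPEN) (hW : sha_dvd_analyticSha)
    (hGZK : rank_eq_analyticRank_of_analyticRank_le_one) (hmod : hasEntireLFunction_rat)
    (h3per : realPeriodRat_eq_unit_mul_plusPeriod_three)
    (W : WeierstrassCurve ℚ) (hWeq : W = ⟨0, 0, 1, -6877, -599225⟩) (hr : W.analyticRank = 0)
    (htam : 2 ≤ padicValNat 3 W.tamagawaProduct + 1)
    {N : ℕ} [NeZero N] (D : ModularParametrizationData W N)
    (ψ : (ℓ : ℕ) → (ZMod ℓ)ˣ →* Multiplicative (ZMod (3 ^ 2)))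
    (hψ : ∀ ℓ ∈ (298531 : ℕ).primeFactors, Function.Surjective (ψ ℓ))
    (hδ : kuriharaNumber D.f (3 ^ 2) 298531 ψ ≠ 0) : BSDp W 3 := by
  subst hWeq
  exact X8RankZero.bsdp_three_of_kim2025_OPEN_of_ainvs_of_kuriharaNumber_ne_zero_pair hK25s hW hGZK hmod
    h3per 0 0 1 (-6877) (-599225)
    (isGloballyMinimal_of_krausCriterion_bounded 0 0 1 (-6877) (-599225)
      (by decide +kernel) (by decide +kernel) (by decide +kernel))
    (by decide) (n₃ := 1) (by decide +kernel) (by decide) surj_x8r0_18515u1_3 hr D (k := 2) (by norm_num)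
    htam 487 613 (by norm_num) (by norm_num) (by norm_num) (by decide) (by decide) (by decide) (by decide)
    (m₁ := 486) (m₂ := 630)
    (by haveI : Fact (Nat.Prime 487) := ⟨by norm_num⟩
        exact natCard_point_eq_of_powForm 0 0 1 (-6877) (-599225) 487 (by norm_num) (by decide)
          (by decide +kernel))
    (by haveI : Fact (Nat.Prime 613) := ⟨by norm_num⟩
        exact natCard_point_eq_of_powForm 0 0 1 (-6877) (-599225) 613 (by norm_num) (by decide)
          (by decide +kernel))
    (by decide) (by decide) (by decide +kernel) (by decide +kernel) (by decide +kernel) (by decide +kernel)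
    (hℓ₁ := ⟨by norm_num⟩) (hℓ₂ := ⟨by norm_num⟩) 298531 (hn0 := ⟨by norm_num⟩) (by norm_num) ψ hψ hδ

end Records

end Summit.BirchSwinnertonDyer.Rank1Residual.Supersingular

end
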